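import Literature.NumberTheory.LFunctions.ZetaScrewThm17Proofs
import HarnessLib

/-!
# Landau detection for Suzuki's `Ψ` with a slack function

`Ψ = zetaScrew` is Suzuki's screw function of `ζ` (Suzuki2023 (1.1)). Suzuki2023 §7.2 proves
`Ψ ≥ 0 ⇒ RH` by Landau's theorem on Laplace transforms of non-negative functions (tree:
`ZetaScrewLandau.riemannXi_ne_zero_of_zetaScrew_nonneg`, `ZetaScrewThm17Proofs.lean`). The same
argument (Montgomery–Vaughan, *Multiplicative Number Theory I*, §15.1 Lemma 15.1, tree
`Landau.integrableOn_of_differentiableOn_union_convex`) runs verbatim on `g(x) = Ψ(log x) + D(log x)`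
for any measurable SLACK FUNCTION `D` with `Ψ ≥ -D` on `[0, ∞)` whose Laplace transform converges
absolutely at `β ≥ 0`: the transform of `g` on `Re s > 1` is `s^{-2}(ξ'/ξ)(1/2 + s) + L_D(s)`
(Suzuki2023 Thm 1.1 (1), tree `mellinIoi_eq_of_re_gt`) with `L_D` holomorphic on `Re s > β`
(`Landau.differentiableOn_mellinIoi_of_forall`), hence holomorphic on `{Re s > 1}` and near the real
segment `[ε₁, 3]` for any `ε₁ > β` (no real zeros of `ξ`); Landau's lemma gives absolute convergence
of `g` — hence of `Ψ∘log` — at every `σ > β`, and the identity-theorem / order-of-vanishing step of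
`ZetaScrewThm17Proofs` excludes zeros of `ξ(1/2 + ·)` with real part `> β`.

## Contents (all proved; no definitions, no named facts)

* (private) `integrableOn_log_rpow_iff` — `D(log x) x^{-(σ+1)} ∈ L¹(1,∞) ↔ D(t) e^{-σt} ∈ L¹(0,∞)`.
* `riemannXi_ne_zero_of_zetaScrew_ge_neg_slack` — the graded detection theorem: slack of Laplace
  class `β ≥ 0` ⇒ `ξ(1/2 + w) ≠ 0` for `Re w > β`.
* `quasiRiemannHypothesis_of_zetaScrew_ge_neg_slack` — the same in `ζ`-language:
  `QuasiRiemannHypothesis (1/2 + β)`.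
* `riemannXi_ne_zero_of_zetaScrew_ge_neg_const`, `riemannHypothesis_of_zetaScrew_ge_neg_const` —
  the constant slack `D ≡ K` (class `β` for every `β > 0`): `Ψ ≥ -K` on `[0, ∞)` already implies RH
  (route-independent restatement of the Summit-side `IntegerScrewDiscreteLandau.robustLandau`).

These are DETECTION theorems about `ζ`'s own screw function (their hypotheses are RH-implied by
Suzuki2023 Thm 1.7); nothing here bears on the truth of RH.

## References

* M. Suzuki, J. Lond. Math. Soc. (2) 108 (2023) 1448–1487; arXiv:2206.03682, Thm 1.1 (1), Thm 1.7,
  §7.2. [Suzuki2023]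
* H. L. Montgomery, R. C. Vaughan, *Multiplicative Number Theory I*, CUP 2007, §15.1 Lemma 15.1.
  [MontgomeryVaughan2007]
-/

noncomputable section

open Complex Filter Topology Set MeasureTheory

namespace Literature.NumberTheory.LFunctions

namespace ZetaScrewLandau

/-! ### The slack function in the Mellin variable -/

/-- `D(log x) x^{-(σ+1)} ∈ L¹(1,∞)` iff `D(t) e^{-σt} ∈ L¹(0,∞)` (substitution `x = e^t`; the case
`D = Ψ` is `integrableOn_zetaScrew_log_iff`; private plumbing). [folklore] -/
private theorem integrableOn_log_rpow_iff (D : ℝ → ℝ) (σ : ℝ) :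
    IntegrableOn (fun x : ℝ ↦ D (Real.log x) * x ^ (-(σ + 1))) (Ioi 1) ↔
      IntegrableOn (fun t : ℝ ↦ D t * Real.exp (-σ * t)) (Ioi 0) := by
  rw [integrableOn_Ioi_one_iff]
  refine integrableOn_congr_fun (fun t _ ↦ ?_) measurableSet_Ioi
  rw [smul_eq_mul, Real.log_exp, Real.rpow_def_of_pos (Real.exp_pos t), Real.log_exp]
  have : Real.exp t * Real.exp (t * -(σ + 1)) = Real.exp (-σ * t) := by
    rw [← Real.exp_add]
    congr 1
    ring
  rw [← this]
  ring

/-! ### Landau detection with a slack function -/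

/-- **Landau detection for `Ψ` with a slack function of Laplace class `β`** (Suzuki2023 §7.2 run
with Montgomery–Vaughan's Lemma 15.1 on `g(x) = Ψ(log x) + D(log x) ≥ 0`). If `D : ℝ → ℝ` is
measurable, `β ≥ 0`, `D(t) e^{-βt}` is integrable on `(0, ∞)` and `Ψ(t) ≥ -D(t)` for all `t ≥ 0`,
then `ξ(1/2 + w₀) ≠ 0` for every `Re w₀ > β`: the transform of `g` is
`s^{-2}(ξ'/ξ)(1/2+s) + L_D(s)` on `Re s > 1` with `L_D` holomorphic on `Re s > β`, it is pole-free
on the real ray `(β, ∞)` (no real zeros of `ξ`), so Landau's lemma pushes the abscissa of `g`, hence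
of `Ψ∘log`, below every `ε > β`, and `F s² ξ(1/2+s) = ξ'(1/2+s)` on `Re s > ε` is incompatible with
a zero of finite order there. The case `D ≡ 0` is `riemannXi_ne_zero_of_zetaScrew_nonneg`.
[cite: MontgomeryVaughan2007, §15.1 Lemma 15.1] -/
theorem riemannXi_ne_zero_of_zetaScrew_ge_neg_slack {D : ℝ → ℝ} (hDm : Measurable D) {β : ℝ} (hβ : 0 ≤ β)
    (hDint : IntegrableOn (fun t : ℝ ↦ D t * Real.exp (-β * t)) (Ioi 0))
    (hΨD : ∀ t : ℝ, 0 ≤ t → -D t ≤ zetaScrew t) :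
    ∀ w₀ : ℂ, β < w₀.re → riemannXi (1 / 2 + w₀) ≠ 0 := by
  intro w₀ hw₀ hzero
  -- zeros of `ξ(1/2 + ·)` have real part `< 1/2`
  have hw₀' : w₀.re < 1 / 2 := by
    by_contra h
    exact riemannXi_ne_zero_of_one_le_re (by simp; linarith) hzero
  have hβ1 : β < 1 / 2 := lt_trans hw₀ hw₀'
  have hg₀ : Measurable (fun x : ℝ ↦ zetaScrew (Real.log x)) :=
    continuous_zetaScrew.measurable.comp Real.measurable_log
  have hD₀ : Measurable (fun x : ℝ ↦ D (Real.log x)) := hDm.comp Real.measurable_log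
  have hg : Measurable (fun x : ℝ ↦ zetaScrew (Real.log x) + D (Real.log x)) := hg₀.add hD₀
  -- the slack's Mellin integrand converges absolutely at every `σ ≥ β`
  have hDσ : ∀ σ : ℝ, β ≤ σ →
      IntegrableOn (fun x : ℝ ↦ D (Real.log x) * x ^ (-(σ + 1))) (Ioi 1) :=
    fun σ hσ ↦ Landau.integrableOn_rpow_of_le hD₀ hσ ((integrableOn_log_rpow_iff D β).2 hDint)
  set R : ℂ → ℂ := fun s ↦ 1 / s ^ 2 * logDeriv riemannXi (1 / 2 + s) with hR_def
  set L : ℂ → ℂ := Landau.mellinIoi (fun x : ℝ ↦ D (Real.log x)) with hL_def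
  set Φ : ℂ → ℂ := fun s ↦ R s + L s with hΦ_def
  have hLd : DifferentiableOn ℂ L {s : ℂ | β < s.re} :=
    Landau.differentiableOn_mellinIoi_of_forall hD₀ fun σ' hσ' ↦ hDσ σ' hσ'.le
  set ε : ℝ := (β + w₀.re) / 2 with hε_def
  have hβε : β < ε := by rw [hε_def]; linarith
  have hεw : ε < w₀.re := by rw [hε_def]; linarith
  have hε1 : ε < 1 := by linarith
  set ε₁ : ℝ := (β + ε) / 2 with hε₁_def
  have hβε₁ : β < ε₁ := by rw [hε₁_def]; linarith
  have hε₁ε : ε₁ < ε := by rw [hε₁_def]; linarith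
  -- a zero-free thin rectangle around the real segment `[ε₁, 3]`
  set Kc : Set ℂ := (fun σ : ℝ ↦ (σ : ℂ)) '' Icc ε₁ 3 with hKc_def
  have hKcc : IsCompact Kc := (isCompact_Icc.image Complex.continuous_ofReal)
  set U : Set ℂ := {s : ℂ | riemannXi (1 / 2 + s) ≠ 0} with hU_def
  have hUo : IsOpen U := by
    have : U = (fun s : ℂ ↦ riemannXi (1 / 2 + s)) ⁻¹' {0}ᶜ := rfl
    rw [this]
    exact isOpen_compl_singleton.preimage (differentiable_riemannXi.continuous.comp (by fun_prop))
  have hKU : Kc ⊆ U := by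
    rintro _ ⟨σ, _, rfl⟩
    exact riemannXi_half_add_ofReal_ne_zero σ
  obtain ⟨d₀, hd₀, hthick⟩ := hKcc.exists_thickening_subset_open hUo hKU
  set W₀ : Set ℂ := {s : ℂ | ε₁ < s.re ∧ s.re < 3 ∧ -d₀ < s.im ∧ s.im < d₀} with hW₀_def
  have hW₀eq : W₀ = {s : ℂ | ε₁ < s.re} ∩ ({s : ℂ | s.re < 3} ∩ ({s : ℂ | -d₀ < s.im} ∩
      {s : ℂ | s.im < d₀})) := by
    ext s; simp [hW₀_def]
  have hW₀o : IsOpen W₀ := by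
    rw [hW₀eq]
    exact (isOpen_lt continuous_const Complex.continuous_re).inter
      ((isOpen_lt Complex.continuous_re continuous_const).inter
        ((isOpen_lt continuous_const Complex.continuous_im).inter
          (isOpen_lt Complex.continuous_im continuous_const)))
  have hW₀c : Convex ℝ W₀ := by
    rw [hW₀eq]
    exact (convex_halfSpace_re_gt _).inter ((convex_halfSpace_re_lt _).inter
      ((convex_halfSpace_im_gt _).inter (convex_halfSpace_im_lt _)))
  have hW₀U : W₀ ⊆ U := by
    intro s hs
    refine hthick (Metric.mem_thickening_iff.2 ⟨(s.re : ℂ), ⟨s.re, ⟨hs.1.le, hs.2.1.le⟩, rfl⟩, ?_⟩)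
    rw [dist_eq_norm]
    have : s - (s.re : ℂ) = (s.im : ℂ) * I := by
      apply Complex.ext <;> simp
    rw [this, norm_mul, Complex.norm_I, mul_one, Complex.norm_real, Real.norm_eq_abs, abs_lt]
    exact ⟨hs.2.2.1, hs.2.2.2⟩
  have hW₀r : ∀ σ : ℝ, ε < σ → σ ≤ 1 + 1 → (σ : ℂ) ∈ W₀ := by
    intro σ h1 h2
    simp only [hW₀_def, Set.mem_setOf_eq, ofReal_re, ofReal_im, neg_lt_zero]
    exact ⟨by linarith, by linarith, hd₀, hd₀⟩
  -- `Φ = R + L_D` is holomorphic on `{Re s > 1} ∪ W₀` (both lie in `Re s > β`, away from `0`)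
  have hΦd : DifferentiableOn ℂ Φ ({s : ℂ | 1 < s.re} ∪ W₀) := by
    intro s hs
    have hsβ : β < s.re := by
      rcases hs with hs | hs
      · simp only [Set.mem_setOf_eq] at hs; linarith
      · exact lt_trans hβε₁ hs.1
    have hs0 : s ≠ 0 := by
      intro h0
      rw [h0, zero_re] at hsβ
      linarith
    have hξ : riemannXi (1 / 2 + s) ≠ 0 := by
      rcases hs with hs | hs
      · exact riemannXi_ne_zero_of_one_le_re (by simp only [Set.mem_setOf_eq] at hs; simp; linarith)
      · exact hW₀U hs
    have h1 : DifferentiableAt ℂ R s := differentiableAt_R hs0 hξ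
    have h2 : DifferentiableAt ℂ L s :=
      (hLd s hsβ).differentiableAt ((Landau.isOpen_re_gt β).mem_nhds hsβ)
    exact (h1.add h2).differentiableWithinAt
  -- and agrees with the transform of `g = Ψ∘log + D∘log` on `Re s > 1`
  have hagree : EqOn Φ (Landau.mellinIoi (fun x : ℝ ↦ zetaScrew (Real.log x) + D (Real.log x)))
      {s : ℂ | 1 < s.re} := by
    intro s hs
    simp only [Set.mem_setOf_eq] at hs
    have hΨint : Integrable (fun x : ℝ ↦ ((zetaScrew (Real.log x) : ℝ) : ℂ) * (x : ℂ) ^ (-(s + 1)))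
        (volume.restrict (Ioi 1)) := by
      have h := Landau.integrable_mellinIntegrand hg₀
        (integrableOn_zetaScrew_log_rpow (σ := 1) (by norm_num)) 0 (s := s) hs
      refine h.congr (Eventually.of_forall fun x ↦ ?_)
      simp [Landau.mellinIntegrand]
    have hDint' : Integrable (fun x : ℝ ↦ ((D (Real.log x) : ℝ) : ℂ) * (x : ℂ) ^ (-(s + 1)))
        (volume.restrict (Ioi 1)) := by
      have h := Landau.integrable_mellinIntegrand hD₀ (hDσ β le_rfl) 0 (s := s) (by linarith)
      refine h.congr (Eventually.of_forall fun x ↦ ?_)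
      simp [Landau.mellinIntegrand]
    have hR : R s = Landau.mellinIoi (fun x : ℝ ↦ zetaScrew (Real.log x)) s :=
      (mellinIoi_eq_of_re_gt (by linarith)).symm
    symm
    calc Landau.mellinIoi (fun x : ℝ ↦ zetaScrew (Real.log x) + D (Real.log x)) s
        = ∫ x in Ioi (1 : ℝ), (((zetaScrew (Real.log x) : ℝ) : ℂ) * (x : ℂ) ^ (-(s + 1))
            + ((D (Real.log x) : ℝ) : ℂ) * (x : ℂ) ^ (-(s + 1))) := by
          unfold Landau.mellinIoi
          refine setIntegral_congr_fun measurableSet_Ioi fun x _ ↦ ?_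
          push_cast
          ring
      _ = Landau.mellinIoi (fun x : ℝ ↦ zetaScrew (Real.log x)) s + L s := by
          rw [integral_add hΨint hDint']
          rfl
      _ = Φ s := by rw [← hR]
  -- Landau for the non-negative `g`: absolute convergence for every `σ > ε`
  have hint : IntegrableOn (fun x : ℝ ↦ (zetaScrew (Real.log x) + D (Real.log x)) * x ^ (-((1 : ℝ) + 1)))
      (Ioi 1) := by
    have h1 := integrableOn_zetaScrew_log_rpow (σ := 1) (by norm_num)
    have h2 := hDσ 1 (by linarith)
    refine (h1.add h2).congr_fun (fun x _ ↦ ?_) measurableSet_Ioi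
    simp only [Pi.add_apply]
    ring
  have hpos : ∀ x : ℝ, 1 < x → 0 ≤ zetaScrew (Real.log x) + D (Real.log x) := by
    intro x hx
    have := hΨD (Real.log x) (Real.log_pos hx).le
    linarith
  have hS' : ∀ σ' : ℝ, ε < σ' →
      IntegrableOn (fun x : ℝ ↦ (zetaScrew (Real.log x) + D (Real.log x)) * x ^ (-(σ' + 1)))
        (Ioi 1) :=
    fun σ' hσ' ↦ Landau.integrableOn_of_differentiableOn_union_convex hg hint le_rfl hpos
      hε1 hW₀o hW₀c hW₀r hΦd hagree hσ'
  -- hence for `Ψ∘log` itself (the slack term is integrable for `σ' > ε > β`)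
  have hS : ∀ σ' : ℝ, ε < σ' →
      IntegrableOn (fun x : ℝ ↦ zetaScrew (Real.log x) * x ^ (-(σ' + 1))) (Ioi 1) := by
    intro σ' hσ'
    refine ((hS' σ' hσ').sub (hDσ σ' (by linarith))).congr_fun (fun x _ ↦ ?_) measurableSet_Ioi
    simp only [Pi.sub_apply]
    ring
  -- from here on verbatim the tree: holomorphy of `F` on `Re s > ε`, identity theorem, orders
  set F : ℂ → ℂ := Landau.mellinIoi (fun x : ℝ ↦ zetaScrew (Real.log x)) with hF_def
  have hFdiff : DifferentiableOn ℂ F {s : ℂ | ε < s.re} :=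
    Landau.differentiableOn_mellinIoi_of_forall hg₀ hS
  have hFR : EqOn F R {s : ℂ | 1 < s.re} := by
    intro s hs
    simp only [Set.mem_setOf_eq] at hs
    exact mellinIoi_eq_of_re_gt (by linarith)
  set H : Set ℂ := {s : ℂ | ε < s.re} with hH_def
  have hHo : IsOpen H := isOpen_lt continuous_const Complex.continuous_re
  have hHpre : IsPreconnected H := (convex_halfSpace_re_gt ε).isPreconnected
  set Z : ℂ → ℂ := fun s ↦ riemannXi (1 / 2 + s) with hZ_def
  have hZd : Differentiable ℂ Z := differentiable_riemannXi.comp (by fun_prop)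
  have hZa : ∀ s, AnalyticAt ℂ Z s := fun s ↦ hZd.analyticAt s
  have hderivZ : ∀ s, deriv Z s = deriv riemannXi (1 / 2 + s) := fun s ↦ by
    simp only [hZ_def]
    exact deriv_comp_const_add riemannXi (1 / 2) s
  set G : ℂ → ℂ := fun s ↦ F s * s ^ 2 with hG_def
  have hGa : ∀ s ∈ H, AnalyticAt ℂ G s := fun s hs ↦
    ((hFdiff.analyticOnNhd hHo) s hs).mul ((analyticAt_id.pow 2))
  have hf₁ : AnalyticOnNhd ℂ (G * Z) H := fun s hs ↦ (hGa s hs).mul (hZa s)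
  have hf₂ : AnalyticOnNhd ℂ (deriv Z) H := fun s _ ↦ (hZa s).deriv
  have h2H : (2 : ℂ) ∈ H := by simp [hH_def]; linarith
  have hev2 : (G * Z) =ᶠ[𝓝 (2 : ℂ)] deriv Z := by
    have hopen : IsOpen {s : ℂ | 1 < s.re} := isOpen_lt continuous_const Complex.continuous_re
    filter_upwards [hopen.mem_nhds (show (2 : ℂ) ∈ {s : ℂ | 1 < s.re} by simp)] with s hs
    have hs' : 1 < s.re := hs
    have hξ : riemannXi (1 / 2 + s) ≠ 0 := riemannXi_ne_zero_of_one_le_re (by simp; linarith)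
    have hs0 : s ≠ 0 := fun h ↦ by rw [h, zero_re] at hs'; linarith
    rw [Pi.mul_apply, hderivZ s]
    simp only [hG_def, hZ_def]
    rw [hFR hs]
    simp only [hR_def]
    rw [logDeriv_apply]
    set A : ℂ := deriv riemannXi (1 / 2 + s)
    set B : ℂ := riemannXi (1 / 2 + s)
    field_simp
  have hEqOn : EqOn (G * Z) (deriv Z) H := hf₁.eqOn_of_preconnected_of_eventuallyEq hf₂ hHpre h2H hev2
  -- orders at `w₀`
  have hw₀H : w₀ ∈ H := by simp [hH_def]; linarith
  have hev : deriv Z =ᶠ[𝓝 w₀] G * Z := by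
    filter_upwards [hHo.mem_nhds hw₀H] with s hs
    exact (hEqOn hs).symm
  have hZ0 : Z w₀ = 0 := hzero
  have h1 : analyticOrderAt (deriv Z) w₀ + 1 = analyticOrderAt Z w₀ := by
    have := (hZa w₀).analyticOrderAt_deriv_add_one
    simpa [hZ0] using this
  have h2 : analyticOrderAt (deriv Z) w₀ = analyticOrderAt G w₀ + analyticOrderAt Z w₀ := by
    rw [analyticOrderAt_congr hev, analyticOrderAt_mul (hGa w₀ hw₀H) (hZa w₀)]
  rw [h2] at h1
  -- `Z` is not locally zero (else `ξ ≡ 0`), so its order is finite, contradiction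
  generalize hoZ : analyticOrderAt Z w₀ = oZ at h1
  generalize hoG : analyticOrderAt G w₀ = oG at h1
  cases oZ with
  | top =>
    have hloc : ∀ᶠ s in 𝓝 w₀, Z s = 0 := analyticOrderAt_eq_top.1 hoZ
    have hall : EqOn Z 0 univ :=
      (hZd.differentiableOn.analyticOnNhd isOpen_univ).eqOn_zero_of_preconnected_of_eventuallyEq_zero
        isPreconnected_univ (Set.mem_univ w₀) hloc
    have h1' : Z 1 = 0 := hall (Set.mem_univ 1)
    simp only [hZ_def] at h1'
    exact riemannXi_ne_zero_of_one_le_re (s := 1 / 2 + 1) (by norm_num) h1'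
  | coe n =>
    cases oG with
    | top => simp at h1
    | coe m =>
      have h' : (m + n + 1 : ℕ) = n := by exact_mod_cast h1
      omega

/-! ### Corollaries in `ζ`-language and the constant slack -/

/-- Slack of Laplace class `β ≥ 0` below `Ψ` ⇒ the quasi-Riemann hypothesis with abscissa
`1/2 + β`: `ζ` has no zero with `1/2 + β < Re s < 1` (zeros of `ζ` in the strip are zeros of `ξ`,
`riemannXi_eq_zero_iff_holds`). [cite: MontgomeryVaughan2007, §15.1 Lemma 15.1] -/
theorem quasiRiemannHypothesis_of_zetaScrew_ge_neg_slack {D : ℝ → ℝ} (hDm : Measurable D)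
    {β : ℝ} (hβ : 0 ≤ β) (hDint : IntegrableOn (fun t : ℝ ↦ D t * Real.exp (-β * t)) (Ioi 0))
    (hΨD : ∀ t : ℝ, 0 ≤ t → -D t ≤ zetaScrew t) :
    QuasiRiemannHypothesis (1 / 2 + β) := by
  intro s hs h1 h2
  have hξ : riemannXi s = 0 := (riemannXi_eq_zero_iff_holds s).2 ⟨hs, by linarith, h2⟩
  have hw : β < (s - 1 / 2).re := by simp; linarith
  refine riemannXi_ne_zero_of_zetaScrew_ge_neg_slack hDm hβ hDint hΨD (s - 1 / 2) hw ?_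
  rw [show (1 / 2 : ℂ) + (s - 1 / 2) = s by ring]
  exact hξ

/-- **Constant slack** (Suzuki2023 §7.2 with `Ψ + K` in place of `Ψ`): if `Ψ(t) ≥ -K` for all
`t ≥ 0` then `ξ(1/2 + w₀) ≠ 0` for every `Re w₀ > 0` (the constant `K` is a slack of Laplace class
`β = Re w₀ / 2 > 0`). [cite: Suzuki2023, §7.2 (proof of Thm 1.7)] -/
theorem riemannXi_ne_zero_of_zetaScrew_ge_neg_const (K : ℝ)
    (hΨ : ∀ t : ℝ, 0 ≤ t → -K ≤ zetaScrew t) (w₀ : ℂ) (hw₀ : 0 < w₀.re) :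
    riemannXi (1 / 2 + w₀) ≠ 0 := by
  have hβ : 0 < w₀.re / 2 := by positivity
  have hint : IntegrableOn (fun t : ℝ ↦ K * Real.exp (-(w₀.re / 2) * t)) (Ioi 0) :=
    (integrableOn_exp_mul_Ioi (by linarith) 0).const_mul K
  exact riemannXi_ne_zero_of_zetaScrew_ge_neg_slack (D := fun _ ↦ K) measurable_const hβ.le hint
    hΨ w₀ (by linarith)

/-- **Constant slack, `ζ`-language:** `Ψ ≥ -K` on `[0, ∞)` implies the Riemann hypothesis (no zero
of `ξ(1/2 + ·)` in `Re > 0`, i.e. none of `ζ` in `1/2 < Re s < 1`, which is RH by the functional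
equation, `quasiRiemannHypothesis_one_half_iff_holds`). [cite: Suzuki2023, §7.2 (proof of Thm 1.7)] -/
theorem riemannHypothesis_of_zetaScrew_ge_neg_const (K : ℝ)
    (hΨ : ∀ t : ℝ, 0 ≤ t → -K ≤ zetaScrew t) : RiemannHypothesis := by
  refine quasiRiemannHypothesis_one_half_iff_holds.1 fun s hs h1 h2 ↦ ?_
  have hξ : riemannXi s = 0 := (riemannXi_eq_zero_iff_holds s).2 ⟨hs, by linarith, h2⟩
  have hw : 0 < (s - 1 / 2).re := by simp; linarith
  refine riemannXi_ne_zero_of_zetaScrew_ge_neg_const K hΨ (s - 1 / 2) hw ?_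
  rw [show (1 / 2 : ℂ) + (s - 1 / 2) = s by ring]
  exact hξ

end ZetaScrewLandau

end Literature.NumberTheory.LFunctions

end
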